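import Summits.Ventures.LatticeQCDFlow.Scaling.OneSidedHubFloor
import Summits.Ventures.LatticeQCDFlow.Scaling.ReplicaExchangeGraphSwapDiffusive
import Summits.Ventures.LatticeQCDFlow.Scaling.ReplicaExchangeDiffusiveTauInt

/-!
HONEST FRAMING: exact (Metropolis-corrected) sampling algorithms for lattice gauge theory; figures
of merit are autocorrelation/cost numbers at stated couplings and volumes; no continuum-physics
claim.

# HubProposalLaw — PROPOSAL LAWS OVER THE SWAP GRAPH AS MULTIPLICITIES: THE LEAST-PROPOSED HUB EDGE IS THE RATE.
# FLOOR `p·min{t·c/(6m), γ₀(1−t)w_0/(14K)}` WHEN EVERY HUB EDGE IS LISTED `≥ c` TIMES; CEILING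
# `t·deg(k)/(2m·μ_k(A)μ_k(Aᶜ))` FROM THE LEAST-CONNECTED IDLE COLD REPLICA, FOR EVERY UPDATE ALLOCATION; ON THE STAR
# NO PROPOSAL LAW BEATS `t/(2Kv)`, AND A LAW WHOSE RAREST HUB EDGE HAS MASS `q = c/m` IS PINNED BETWEEN
# `p·min{tq/6, γ₀(1−t)/(14K)}` AND `tq/(2v)` (lean-2 GEN-23, ours)

Venture-side (OURS).  Cell `lqcd-flow` (pub-lqcd), unit `pub-lqcd-lean-2-g23`, 2026-08-26.  Chapter K, file 2.  Setting
of `Scaling/SwapGraphDilution` (K1): `P = t·ptGraphSwap μ e φ + (1−t)·prodKernel w M` over an edge LIST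
`e : Fin m → Fin (K+1) × Fin (K+1)` drawn uniformly.  A list may repeat pairs, so it encodes every rational PROPOSAL
LAW over the pairs of replicas: the pair `(i,l)` is proposed with probability `#{r : e_r = (i,l)}/m`.  This file
reads the rate of the hub schemes off the multiplicities: the one-sided floor of `Scaling/OneSidedHubFloor` (J8,
`c = 1`) gains the factor `c` = the least multiplicity of a hub edge `(0, k+1)`, and a single idle cold replica of
LIST-DEGREE `deg(k)` caps the gap at `t·deg(k)/(2m·μ_k(A)μ_k(Aᶜ))` whatever the other replicas, the maps elsewhere and
the update allocation do.

## What is proved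

* §1 **`ptGraphProposal_hubEdge_ge`** (`T(x, x∘τ_k) ≥ c_k/m`, `c_k` the multiplicity of `(0, k+1)` in the list, identity
  maps), **`multiHub_swap_flow_ge`** (`π̃(x)P(x, x∘τ_k) ≥ (tc/m)·min{π̃(x), π̃(x∘τ_k)}` for `c ≤ c_k`).
* §2 **`multiHub_poincare`**, **`multiHub_spectralGap_ge`** — one-sided domination `p·μ_{k+1} ≤ μ_0`, hot Poincaré
  constant `γ₀`, `w_0 > 0`, every hub edge listed at least `c ≥ 1` times:
  **`Gap(P) ≥ p·min{t·c/(6m), γ₀(1−t)w_0/(14K)}`** (J8 is `c = 1`).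
* §3 **`prodKernel_dirichletForm_profileCount`**, **`weightedGraph_spectralGap_le_profile`** — THE WEIGHTED PROFILE
  CEILING (G2's `ptGraph_spectralGap_le_profile` for every update allocation `w`):
  `Gap(P) ≤ [t·(2m)⁻¹Σ_r (a_{i_r} − a_{l_r})²D_r(A) + (1−t)Σ_k w_k a_k² Q_k(A,Aᶜ)]/Σ_k a_k² μ_k(A)μ_k(Aᶜ)`.
* §4 **`leastConnected_spectralGap_le`** — ONE IDLE REPLICA CAPS THE RATE: for any level
  `k` with `w_k·Q_k(A,Aᶜ) = 0` and `μ_k(A)μ_k(Aᶜ) > 0`, sector-preserving maps: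
  **`Gap(P) ≤ t·deg(k)/(2m·μ_k(A)μ_k(Aᶜ))`**, `deg(k) = #{r : e_r touches k}`.
* §5 THE PROPOSAL LAW ON THE STAR (every entry a hub edge `(0, k+1)`, hot-only updates):
  **`multistar_spectralGap_two_sided`** — `p·min{t·c/(6m), γ₀(1−t)/(14K)} ≤ Gap(P) ≤ t·c_k/(2m·v)` for every `k`
  (`c ≤ c_k`; one-sided domination; `μ_{k+1}(A)μ_{k+1}(Aᶜ) ≥ v`): the rarest hub edge is the rate, two-sided;
  `exists_hubMult_le` (`Σ_k c_k ≤ m ⇒ ∃ k, K·c_k ≤ m`), **`multistar_spectralGap_le_uniformLaw`** — WHATEVER THE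
  PROPOSAL LAW over the hub edges, `Gap(P) ≤ t/(2K·v)`: the uniform law (`c_k = m/K`, floor `p·min{t/(6K), …}`) is
  optimal up to the constant, and every deviation from it costs linearly through the rarest edge.

Reading (no numerics implied): the freedom to choose WHICH pair to propose, with any fixed frequencies, is worth
nothing beyond the uniform hub over one tunnelling replica and idle cold replicas: the replica offered the hot
configuration least often relaxes last, at exactly its proposal frequency.  NOT CLAIMED: state-dependent pair selection;
cold replicas relaxing within sectors; continuous spaces; anything measured.  Literature grade (cell rule): KNOWN
MECHANISM (canonical paths / test functions), NEW TYPING; nothing cited as a fact; no new bib keys.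
-/

noncomputable section

open Finset Function
open Literature.Probability.MarkovChains

namespace Summit.Ventures.LatticeQCDFlow.Scaling

variable {S : Type*} [Fintype S] [DecidableEq S] {K m : ℕ} {μ : Fin (K + 1) → S → ℝ}
  {M : Fin (K + 1) → S → S → ℝ} {w : Fin (K + 1) → ℝ} {t : ℝ} {e : Fin m → Fin (K + 1) × Fin (K + 1)}
  {φ : Fin m → Equiv.Perm S}

/-! ## §1 Multiplicities are proposal probabilities -/

omit [Fintype S] in
/-- **The hub edge `(0, k+1)` listed `c_k` times is proposed with probability `≥ c_k/m`:**
`T(x, x∘τ_k) ≥ #{r : e_r = (0, k+1)}/m` (identity maps). [ours] -/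
theorem ptGraphProposal_hubEdge_ge (e : Fin m → Fin (K + 1) × Fin (K + 1)) (k : Fin K) (x : Fin (K + 1) → S) :
    ((univ.filter (fun r : Fin m => e r = ((0 : Fin (K + 1)), k.succ))).card : ℝ) / m
      ≤ ptGraphProposal e (fun _ : Fin m => Equiv.refl S) x (x ∘ Equiv.swap (0 : Fin (K + 1)) k.succ) := by
  unfold ptGraphProposal
  set F := univ.filter (fun r : Fin m => e r = ((0 : Fin (K + 1)), k.succ)) with hF
  have hterm : ∀ r ∈ F, (if x ∘ Equiv.swap (0 : Fin (K + 1)) k.succ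
      = edgeFlowSwap ((fun _ : Fin m => Equiv.refl S) r) (e r).1 (e r).2 x then (1 : ℝ) / m else 0) = 1 / m := by
    intro r hr
    have her : e r = ((0 : Fin (K + 1)), k.succ) := (Finset.mem_filter.mp hr).2
    rw [her]
    simp only
    rw [edgeFlowSwap_one (Fin.succ_ne_zero k).symm, if_pos rfl]
  calc (F.card : ℝ) / m = ∑ _r ∈ F, (1 : ℝ) / m := by rw [Finset.sum_const, nsmul_eq_mul, mul_one_div]
    _ = ∑ r ∈ F, (if x ∘ Equiv.swap (0 : Fin (K + 1)) k.succ
          = edgeFlowSwap ((fun _ : Fin m => Equiv.refl S) r) (e r).1 (e r).2 x then (1 : ℝ) / m else 0) :=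
        (Finset.sum_congr rfl hterm).symm
    _ ≤ _ := Finset.sum_le_univ_sum_of_nonneg fun r => by split_ifs <;> positivity

/-- **Hub swap flows with multiplicity:** if every hub edge `(0, k+1)` is listed at least `c` times (identity maps,
distinct endpoints, `w` a probability vector, `0 ≤ t ≤ 1`):
`π̃(x)·P(x, x∘τ_k) ≥ (t·c/m)·min{π̃(x), π̃(x∘τ_k)}` for `x∘τ_k ≠ x`. [ours] -/
theorem multiHub_swap_flow_ge (e : Fin m → Fin (K + 1) × Fin (K + 1)) (he : ∀ j, (e j).1 ≠ (e j).2)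
    (hμ : ∀ k x, 0 < μ k x) (hM : ∀ k, IsRowStochastic (M k)) (hw0 : ∀ k, 0 ≤ w k) (hw1 : ∑ k, w k = 1)
    (ht0 : 0 ≤ t) (ht1 : t ≤ 1) {c : ℕ}
    (hc : ∀ k : Fin K, c ≤ (univ.filter (fun r : Fin m => e r = ((0 : Fin (K + 1)), k.succ))).card)
    (x : Fin (K + 1) → S) (k : Fin K) (hx : x ∘ Equiv.swap (0 : Fin (K + 1)) k.succ ≠ x) :
    t * c / m * min (tensorFun μ x) (tensorFun μ (x ∘ Equiv.swap (0 : Fin (K + 1)) k.succ))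
      ≤ tensorFun μ x * (t * ptGraphSwap μ e (fun _ : Fin m => Equiv.refl S) x (x ∘ Equiv.swap (0 : Fin (K + 1)) k.succ)
          + (1 - t) * prodKernel w M x (x ∘ Equiv.swap (0 : Fin (K + 1)) k.succ)) := by
  have hU := prodKernel_isRowStochastic M w hw0 hw1 hM
  have hT : (c : ℝ) / m
      ≤ ptGraphProposal e (fun _ : Fin m => Equiv.refl S) x (x ∘ Equiv.swap (0 : Fin (K + 1)) k.succ) :=
    le_trans (div_le_div_of_nonneg_right (by exact_mod_cast hc k) (Nat.cast_nonneg m))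
      (ptGraphProposal_hubEdge_ge e k x)
  rw [mul_add, ← mul_assoc, mul_comm (tensorFun μ x) t, mul_assoc, tensorFun_mul_ptGraphSwap hμ he hx]
  have hmin : 0 ≤ min (tensorFun μ x) (tensorFun μ (x ∘ Equiv.swap (0 : Fin (K + 1)) k.succ)) :=
    le_min (tensorFun_pos hμ _).le (tensorFun_pos hμ _).le
  have hupd : 0 ≤ tensorFun μ x * ((1 - t) * prodKernel w M x (x ∘ Equiv.swap (0 : Fin (K + 1)) k.succ)) :=
    mul_nonneg (tensorFun_pos hμ x).le (mul_nonneg (by linarith) (hU.1 _ _))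
  calc t * c / m * min (tensorFun μ x) (tensorFun μ (x ∘ Equiv.swap (0 : Fin (K + 1)) k.succ))
      = t * ((c : ℝ) / m * min (tensorFun μ x) (tensorFun μ (x ∘ Equiv.swap (0 : Fin (K + 1)) k.succ))) := by ring
    _ ≤ t * (ptGraphProposal e (fun _ : Fin m => Equiv.refl S) x (x ∘ Equiv.swap (0 : Fin (K + 1)) k.succ)
          * min (tensorFun μ x) (tensorFun μ (x ∘ Equiv.swap (0 : Fin (K + 1)) k.succ))) :=
        mul_le_mul_of_nonneg_left (mul_le_mul_of_nonneg_right hT hmin) ht0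
    _ ≤ _ := le_add_of_nonneg_right hupd

/-! ## §2 The one-sided floor with multiplicity -/

/-- **THE ONE-SIDED HUB POINCARÉ INEQUALITY WITH MULTIPLICITY:** edge list of `m ≥ 1` entries (distinct endpoints,
identity maps) listing every hub edge `(0, k+1)` at least `c` times, weights `w ≥ 0` with `Σw = 1` and `w_0 > 0`,
`0 < t < 1`, hot Poincaré constant `γ₀`, one-sided domination `p·μ_{k+1}(u) ≤ μ_0(u)`:
`C·Var_π̃(f) ≤ 𝓔_π̃(P; f)` whenever `C·6m ≤ p·t·c` and `C·2(p+6K) ≤ pγ₀(1−t)w_0`. [ours] -/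
theorem multiHub_poincare (hm : 1 ≤ m) (he : ∀ r, (e r).1 ≠ (e r).2) {c : ℕ}
    (hc : ∀ k : Fin K, c ≤ (univ.filter (fun r : Fin m => e r = ((0 : Fin (K + 1)), k.succ))).card) (hc1 : 1 ≤ c)
    (hμ : ∀ k x, 0 < μ k x) (hμ1 : ∀ k, ∑ u, μ k u = 1) (hM : ∀ k, IsRowStochastic (M k)) (hw0 : ∀ k, 0 ≤ w k)
    (hw1 : ∑ k, w k = 1) (hwhot : 0 < w 0) (ht0 : 0 < t) (ht1 : t < 1) {p γ₀ : ℝ} (hp : 0 < p) (hγ₀ : 0 < γ₀)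
    (hdom : ∀ (k : Fin K) (u : S), p * μ k.succ u ≤ μ 0 u)
    (hgap0 : ∀ h : S → ℝ, γ₀ * lawVariance (μ 0) h ≤ dirichletForm (μ 0) (M 0) h)
    (f : (Fin (K + 1) → S) → ℝ) {C : ℝ} (hC0 : 0 ≤ C) (hC1 : C * (6 * m) ≤ p * t * c)
    (hC2 : C * (2 * (p + 6 * K)) ≤ p * γ₀ * ((1 - t) * w 0)) :
    C * lawVariance (tensorFun μ) f
      ≤ dirichletForm (tensorFun μ) (fun x y : Fin (K + 1) → S =>
          t * ptGraphSwap μ e (fun _ : Fin m => Equiv.refl S) x y + (1 - t) * prodKernel w M x y) f := by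
  have hmpos : (0 : ℝ) < m := Nat.cast_pos.mpr (by omega)
  have hGS0 : ∀ x y, 0 ≤ ptGraphSwap μ e (fun _ : Fin m => Equiv.refl S) x y := (ptGraphSwap_isRowStochastic hμ).1
  have hP0 := (weightedScheme_isRowStochastic (t := t) (w := w) (ptGraphSwap_isRowStochastic (e := e)
    (φ := fun _ : Fin m => Equiv.refl S) hμ) hM hw0 hw1 ht0.le ht1.le).1
  refine starConveyor_poincare (ν := μ) (Q := fun x y : Fin (K + 1) → S =>
      t * ptGraphSwap μ e (fun _ : Fin m => Equiv.refl S) x y + (1 - t) * prodKernel w M x y) (Q₀ := M 0)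
    hμ hμ1 hp hdom (by positivity : 0 < t * c / m) hγ₀ (mul_pos (by linarith) hwhot : (0 : ℝ) < (1 - t) * w 0) hP0
    ?_ hgap0 ?_ f hC0 ?_ ?_
  · intro x k hx
    exact multiHub_swap_flow_ge e he hμ hM hw0 hw1 ht0.le ht1.le hc x k hx
  · intro x v hv
    exact whub_hot_flow_ge (M := M) (w := w) hGS0 hμ ht0.le x hv
  · rw [show p * (t * c / m) = p * t * c / m by ring, le_div_iff₀ hmpos]
    calc C * 6 * m = C * (6 * m) := by ring
      _ ≤ p * t * c := hC1
  · exact hC2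

/-- **THE ONE-SIDED FLOOR WITH MULTIPLICITY: `Gap(P) ≥ p·min{t·c/(6m), γ₀(1−t)w_0/(14K)}`** (`K ≥ 1`, `p ≤ 1`, `|S| ≥ 2`,
`0 < t < 1`, every hub edge listed `≥ c ≥ 1` times; cold updates arbitrary `μ_k`-reversible). [ours] -/
theorem multiHub_spectralGap_ge [Nontrivial S] (hK : 1 ≤ K) (hm : 1 ≤ m) (he : ∀ r, (e r).1 ≠ (e r).2) {c : ℕ}
    (hc : ∀ k : Fin K, c ≤ (univ.filter (fun r : Fin m => e r = ((0 : Fin (K + 1)), k.succ))).card) (hc1 : 1 ≤ c)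
    (hμ : ∀ k x, 0 < μ k x) (hμ1 : ∀ k, ∑ u, μ k u = 1) (hM : ∀ k, IsRowStochastic (M k))
    (hMrev : ∀ k, DetailedBalance (μ k) (M k)) (hw0 : ∀ k, 0 ≤ w k) (hw1 : ∑ k, w k = 1) (hwhot : 0 < w 0)
    (ht0 : 0 < t) (ht1 : t < 1) {p γ₀ : ℝ} (hp : 0 < p) (hp1 : p ≤ 1) (hγ₀ : 0 < γ₀)
    (hdom : ∀ (k : Fin K) (u : S), p * μ k.succ u ≤ μ 0 u)
    (hgap0 : ∀ h : S → ℝ, γ₀ * lawVariance (μ 0) h ≤ dirichletForm (μ 0) (M 0) h) :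
    p * min (t * c / (6 * m)) (γ₀ * (1 - t) * w 0 / (14 * K))
      ≤ spectralGap (tensorFun μ) (fun x y : Fin (K + 1) → S =>
          t * ptGraphSwap μ e (fun _ : Fin m => Equiv.refl S) x y + (1 - t) * prodKernel w M x y) := by
  have hKr : (1 : ℝ) ≤ K := by exact_mod_cast hK
  have hmpos : (0 : ℝ) < m := Nat.cast_pos.mpr (by omega)
  have h1t : 0 < 1 - t := by linarith
  set m₀ := min (t * c / (6 * m)) (γ₀ * (1 - t) * w 0 / (14 * K)) with hm₀
  refine le_spectralGap_of_poincare (tensorFun_pos hμ) (sum_tensorFun_eq_one μ hμ1)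
    (weightedScheme_isRowStochastic (ptGraphSwap_isRowStochastic hμ) hM hw0 hw1 ht0.le ht1.le)
    (weightedScheme_detailedBalance (ptGraphSwap_detailedBalance hμ) hMrev t) fun f => ?_
  refine multiHub_poincare hm he hc hc1 hμ hμ1 hM hw0 hw1 hwhot ht0 ht1 hp hγ₀ hdom hgap0 f
    (mul_nonneg hp.le (le_min (by positivity) (by positivity))) ?_ ?_
  · have h1 : m₀ ≤ t * c / (6 * m) := min_le_left _ _
    calc p * m₀ * (6 * m) ≤ p * (t * c / (6 * m)) * (6 * m) :=
          mul_le_mul_of_nonneg_right (mul_le_mul_of_nonneg_left h1 hp.le) (by positivity)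
      _ = p * t * c := by field_simp
  · have h2 : m₀ ≤ γ₀ * (1 - t) * w 0 / (14 * K) := min_le_right _ _
    have h3 : 2 * (p + 6 * (K : ℝ)) ≤ 14 * K := by nlinarith
    calc p * m₀ * (2 * (p + 6 * K)) ≤ p * (γ₀ * (1 - t) * w 0 / (14 * K)) * (14 * K) := by
          have := mul_le_mul h2 h3 (by positivity) (by positivity)
          nlinarith
      _ = p * γ₀ * ((1 - t) * w 0) := by field_simp

/-! ## §3 The weighted profile ceiling -/

/-- **`𝓔_π̃(prodKernel w M; G_a) = Σ_k w_k·a_k²·Q_k(A,Aᶜ)`** for the profile count `G_a(x) = Σ_k a_k f_A^{(μ_k)}(x_k)` —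
one replica moves at a time, replica `k` with probability `w_k`. [ours] -/
theorem prodKernel_dirichletForm_profileCount (hμ1 : ∀ k, ∑ u, μ k u = 1) (hM : ∀ k, IsRowStochastic (M k))
    (hMrev : ∀ k, DetailedBalance (μ k) (M k)) (w : Fin (K + 1) → ℝ) (a : Fin (K + 1) → ℝ) (A : Finset S) :
    dirichletForm (tensorFun μ) (prodKernel w M) (fun x => ∑ k, a k * bottleneckTestFun (μ k) A (x k))
      = ∑ k, w k * (a k ^ 2 * edgeMeasure (μ k) (M k) A Aᶜ) := by
  rw [dirichletForm_prodKernel_additive μ hμ1 w M (fun k u => a k * bottleneckTestFun (μ k) A u)]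
  refine sum_congr rfl fun k _ => ?_
  rw [dirichletForm_smul, dirichletForm_bottleneckTestFun (hM k) ((hMrev k).isStationary (hM k).2) (hμ1 k) A]

/-- **THE WEIGHTED PROFILE CEILING ON A SWAP GRAPH (sector-preserving maps, any update allocation `w`):**
`Gap(P) ≤ [t·(2m)⁻¹·Σ_r (a_{i_r} − a_{l_r})²·D_r(A) + (1−t)·Σ_k w_k a_k²·Q_k(A,Aᶜ)] / Σ_k a_k²·μ_k(A)μ_k(Aᶜ)`
(`0 ≤ t ≤ 1`, `|S| ≥ 2`, distinct endpoints, the denominator positive). [ours] -/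
theorem weightedGraph_spectralGap_le_profile [Nontrivial S] (hμ : ∀ k x, 0 < μ k x) (hμ1 : ∀ k, ∑ u, μ k u = 1)
    (hM : ∀ k, IsRowStochastic (M k)) (hMrev : ∀ k, DetailedBalance (μ k) (M k)) (hw0 : ∀ k, 0 ≤ w k)
    (hw1 : ∑ k, w k = 1) (ht0 : 0 ≤ t) (ht1 : t ≤ 1) (he : ∀ r, (e r).1 ≠ (e r).2) (a : Fin (K + 1) → ℝ)
    {A : Finset S} (hφA : ∀ r u, φ r u ∈ A ↔ u ∈ A) (hA : 0 < ∑ k, a k ^ 2 * ((∑ u ∈ A, μ k u) * ∑ u ∈ Aᶜ, μ k u)) :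
    spectralGap (tensorFun μ) (fun x y : Fin (K + 1) → S => t * ptGraphSwap μ e φ x y + (1 - t) * prodKernel w M x y)
      ≤ (t * (1 / (2 * m) * ∑ r : Fin m, (a (e r).1 - a (e r).2) ^ 2
            * ((∑ u ∈ A, μ (e r).1 u) * (∑ u ∈ Aᶜ, μ (e r).2 u)
              + (∑ u ∈ Aᶜ, μ (e r).1 u) * ∑ u ∈ A, μ (e r).2 u))
          + (1 - t) * ∑ k, w k * (a k ^ 2 * edgeMeasure (μ k) (M k) A Aᶜ))
        / ∑ k, a k ^ 2 * ((∑ u ∈ A, μ k u) * ∑ u ∈ Aᶜ, μ k u) := by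
  have hQ := ptGraphSwap_isRowStochastic (e := e) (φ := φ) hμ
  have hQrev := ptGraphSwap_detailedBalance (e := e) (φ := φ) hμ
  have hP := weightedScheme_isRowStochastic (t := t) (w := w) hQ hM hw0 hw1 ht0 ht1
  have hDB := weightedScheme_detailedBalance (w := w) hQrev hMrev t
  have hray := LevinPeres2017_lemma_13_7_rayleigh (tensorFun_pos hμ) (sum_tensorFun_eq_one μ hμ1) hP hDB
    (ptBare_mean_profileCount (μ := μ) hμ1 a A)
  rw [ptBare_piInner_profileCount hμ1 a A, weightedScheme_dirichletForm (Q := ptGraphSwap μ e φ) (w := w) (M := M),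
    prodKernel_dirichletForm_profileCount hμ1 hM hMrev w a A] at hray
  have hsw := ptGraph_dirichletForm_swap_profileCount_le (μ := μ) (e := e) (φ := φ) hμ hμ1 he a hφA
  rw [le_div_iff₀ hA]
  calc spectralGap (tensorFun μ) (fun x y : Fin (K + 1) → S =>
          t * ptGraphSwap μ e φ x y + (1 - t) * prodKernel w M x y)
        * ∑ k, a k ^ 2 * ((∑ u ∈ A, μ k u) * ∑ u ∈ Aᶜ, μ k u)
      ≤ t * dirichletForm (tensorFun μ) (ptGraphSwap μ e φ) (fun x => ∑ k, a k * bottleneckTestFun (μ k) A (x k))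
          + (1 - t) * ∑ k, w k * (a k ^ 2 * edgeMeasure (μ k) (M k) A Aᶜ) := hray
    _ ≤ _ := by
        have := mul_le_mul_of_nonneg_left hsw ht0
        linarith

/-! ## §4 One idle replica caps the rate -/

/-- **ONE IDLE REPLICA CAPS THE RATE:** for any level `k` with `w_k·Q_k(A,Aᶜ) = 0` (never updated, or frozen in the
sector under its own update) and `μ_k(A)μ_k(Aᶜ) > 0`, sector-preserving maps, `m ≥ 1`:
**`Gap(P) ≤ t·deg(k)/(2m·μ_k(A)μ_k(Aᶜ))`**, `deg(k)` the number of list entries with an endpoint at `k` — replica `k`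
learns the sector only by an exchange, proposed with probability `deg(k)/m` per swap step. [ours] -/
theorem leastConnected_spectralGap_le [Nontrivial S] (hm : 1 ≤ m) (he : ∀ r, (e r).1 ≠ (e r).2)
    (hμ : ∀ k x, 0 < μ k x) (hμ1 : ∀ k, ∑ u, μ k u = 1) (hM : ∀ k, IsRowStochastic (M k))
    (hMrev : ∀ k, DetailedBalance (μ k) (M k)) (hw0 : ∀ k, 0 ≤ w k) (hw1 : ∑ k, w k = 1) (ht0 : 0 ≤ t)
    (ht1 : t ≤ 1) {A : Finset S} (hφA : ∀ r u, φ r u ∈ A ↔ u ∈ A) (k : Fin (K + 1))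
    (hAk : 0 < (∑ u ∈ A, μ k u) * ∑ u ∈ Aᶜ, μ k u) (hidle : w k * edgeMeasure (μ k) (M k) A Aᶜ = 0) :
    spectralGap (tensorFun μ) (fun x y : Fin (K + 1) → S => t * ptGraphSwap μ e φ x y + (1 - t) * prodKernel w M x y)
      ≤ t * ((univ.filter fun r : Fin m => (e r).1 = k ∨ (e r).2 = k).card : ℝ)
          / (2 * m * ((∑ u ∈ A, μ k u) * ∑ u ∈ Aᶜ, μ k u)) := by
  have hmpos : (0 : ℝ) < m := Nat.cast_pos.mpr (by omega)
  set a : Fin (K + 1) → ℝ := fun i => if i = k then (1 : ℝ) else 0 with ha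
  -- the denominator and the update term see only level `k`
  have hden : ∑ i, a i ^ 2 * ((∑ u ∈ A, μ i u) * ∑ u ∈ Aᶜ, μ i u) = (∑ u ∈ A, μ k u) * ∑ u ∈ Aᶜ, μ k u := by
    simp_rw [ha, ite_pow, one_pow, zero_pow two_ne_zero, ite_mul, one_mul, zero_mul]
    rw [Finset.sum_ite_eq' univ k, if_pos (mem_univ _)]
  have hupd : ∑ i, w i * (a i ^ 2 * edgeMeasure (μ i) (M i) A Aᶜ) = 0 := by
    simp_rw [ha, ite_pow, one_pow, zero_pow two_ne_zero, ite_mul, one_mul, zero_mul, mul_ite, mul_zero]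
    rw [Finset.sum_ite_eq' univ k, if_pos (mem_univ _)]; exact hidle
  -- the swap term: only entries touching `k`, each at most one
  have hsw : ∑ r : Fin m, (a (e r).1 - a (e r).2) ^ 2
        * ((∑ u ∈ A, μ (e r).1 u) * (∑ u ∈ Aᶜ, μ (e r).2 u) + (∑ u ∈ Aᶜ, μ (e r).1 u) * ∑ u ∈ A, μ (e r).2 u)
      ≤ ((univ.filter fun r : Fin m => (e r).1 = k ∨ (e r).2 = k).card : ℝ) := by
    have hpt : ∀ r : Fin m, (a (e r).1 - a (e r).2) ^ 2
        * ((∑ u ∈ A, μ (e r).1 u) * (∑ u ∈ Aᶜ, μ (e r).2 u) + (∑ u ∈ Aᶜ, μ (e r).1 u) * ∑ u ∈ A, μ (e r).2 u)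
        ≤ if (e r).1 = k ∨ (e r).2 = k then (1 : ℝ) else 0 := by
      intro r
      have hD := levelDisagreement_le_one μ (fun i u => (hμ i u).le) hμ1 A (e r).1 (e r).2
      have hD0 : 0 ≤ (∑ u ∈ A, μ (e r).1 u) * (∑ u ∈ Aᶜ, μ (e r).2 u)
          + (∑ u ∈ Aᶜ, μ (e r).1 u) * ∑ u ∈ A, μ (e r).2 u :=
        add_nonneg (mul_nonneg (sum_nonneg fun u _ => (hμ _ u).le) (sum_nonneg fun u _ => (hμ _ u).le))
          (mul_nonneg (sum_nonneg fun u _ => (hμ _ u).le) (sum_nonneg fun u _ => (hμ _ u).le))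
      have hak : ∀ i, a i = if i = k then (1 : ℝ) else 0 := fun i => by rw [ha]
      by_cases h1 : (e r).1 = k
      · have h2 : (e r).2 ≠ k := fun h2 => he r (h1.trans h2.symm)
        rw [if_pos (Or.inl h1), hak, hak, if_pos h1, if_neg h2]; nlinarith
      · by_cases h2 : (e r).2 = k
        · rw [if_pos (Or.inr h2), hak, hak, if_neg h1, if_pos h2]; nlinarith
        · rw [if_neg (not_or.mpr ⟨h1, h2⟩), hak, hak, if_neg h1, if_neg h2]; nlinarith
    refine (sum_le_sum fun r _ => hpt r).trans (le_of_eq ?_)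
    rw [Finset.sum_boole]
  have h := weightedGraph_spectralGap_le_profile (t := t) (w := w) (M := M) (e := e) (φ := φ) hμ hμ1 hM hMrev hw0
    hw1 ht0 ht1 he a hφA (hden ▸ hAk)
  rw [hden, hupd, mul_zero, add_zero] at h
  refine h.trans ?_
  rw [div_le_div_iff₀ hAk (by positivity)]
  have := mul_le_mul_of_nonneg_left hsw ht0
  have hAk' := hAk.le
  calc t * (1 / (2 * m) * ∑ r : Fin m, (a (e r).1 - a (e r).2) ^ 2
          * ((∑ u ∈ A, μ (e r).1 u) * (∑ u ∈ Aᶜ, μ (e r).2 u) + (∑ u ∈ Aᶜ, μ (e r).1 u) * ∑ u ∈ A, μ (e r).2 u))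
        * (2 * m * ((∑ u ∈ A, μ k u) * ∑ u ∈ Aᶜ, μ k u))
      = (t * ∑ r : Fin m, (a (e r).1 - a (e r).2) ^ 2
          * ((∑ u ∈ A, μ (e r).1 u) * (∑ u ∈ Aᶜ, μ (e r).2 u) + (∑ u ∈ Aᶜ, μ (e r).1 u) * ∑ u ∈ A, μ (e r).2 u))
        * ((∑ u ∈ A, μ k u) * ∑ u ∈ Aᶜ, μ k u) := by
          field_simp
    _ ≤ t * ((univ.filter fun r : Fin m => (e r).1 = k ∨ (e r).2 = k).card : ℝ)
        * ((∑ u ∈ A, μ k u) * ∑ u ∈ Aᶜ, μ k u) := mul_le_mul_of_nonneg_right this hAk'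

/-! ## §5 The proposal law on the star -/

/-- On a list of hub edges (`(e r).1 = 0` for all `r`) the list-degree of the cold level `k+1` is the multiplicity
of `(0, k+1)`. [ours] -/
theorem multistar_deg_eq (hstar : ∀ r, (e r).1 = 0) (k : Fin K) :
    (univ.filter fun r : Fin m => (e r).1 = k.succ ∨ (e r).2 = k.succ)
      = univ.filter (fun r : Fin m => e r = ((0 : Fin (K + 1)), k.succ)) := by
  refine Finset.filter_congr fun r _ => ?_
  rw [Prod.ext_iff]; simp only [hstar r, (Fin.succ_ne_zero k).symm, false_or, true_and]

/-- **THE PROPOSAL LAW ON THE STAR, TWO-SIDED:** every entry a hub edge (`(e r).1 = 0`, distinct endpoints), every hub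
edge listed `≥ c ≥ 1` times, hot-only updates (`w = 𝟙_{k=0}`), hot Poincaré constant `γ₀`, one-sided domination
`p·μ_{k+1} ≤ μ_0`, and a sector `A` with `μ_{k+1}(A)μ_{k+1}(Aᶜ) ≥ v > 0`: for every cold level `k+1` of multiplicity
`c_k`, **`p·min{t·c/(6m), γ₀(1−t)/(14K)} ≤ Gap(P) ≤ t·c_k/(2m·v)`** — the rarest hub edge is the rate. [ours] -/
theorem multistar_spectralGap_two_sided [Nontrivial S] (hK : 1 ≤ K) (hm : 1 ≤ m) (hstar : ∀ r, (e r).1 = 0)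
    (he : ∀ r, (e r).1 ≠ (e r).2) {c : ℕ}
    (hc : ∀ k : Fin K, c ≤ (univ.filter (fun r : Fin m => e r = ((0 : Fin (K + 1)), k.succ))).card) (hc1 : 1 ≤ c)
    (hμ : ∀ k x, 0 < μ k x) (hμ1 : ∀ k, ∑ u, μ k u = 1) (hM : ∀ k, IsRowStochastic (M k))
    (hMrev : ∀ k, DetailedBalance (μ k) (M k)) (ht0 : 0 < t) (ht1 : t < 1) {p γ₀ : ℝ} (hp : 0 < p) (hp1 : p ≤ 1)
    (hγ₀ : 0 < γ₀) (hdom : ∀ (k : Fin K) (u : S), p * μ k.succ u ≤ μ 0 u)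
    (hgap0 : ∀ g : S → ℝ, γ₀ * lawVariance (μ 0) g ≤ dirichletForm (μ 0) (M 0) g) {A : Finset S} {v : ℝ}
    (hvpos : 0 < v) (k : Fin K) (hv : v ≤ (∑ u ∈ A, μ k.succ u) * ∑ u ∈ Aᶜ, μ k.succ u) :
    p * min (t * c / (6 * m)) (γ₀ * (1 - t) / (14 * K))
        ≤ spectralGap (tensorFun μ) (fun x y : Fin (K + 1) → S =>
            t * ptGraphSwap μ e (fun _ : Fin m => Equiv.refl S) x y
              + (1 - t) * prodKernel (fun i : Fin (K + 1) => if i = 0 then (1 : ℝ) else 0) M x y)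
      ∧ spectralGap (tensorFun μ) (fun x y : Fin (K + 1) → S =>
            t * ptGraphSwap μ e (fun _ : Fin m => Equiv.refl S) x y
              + (1 - t) * prodKernel (fun i : Fin (K + 1) => if i = 0 then (1 : ℝ) else 0) M x y)
          ≤ t * ((univ.filter (fun r : Fin m => e r = ((0 : Fin (K + 1)), k.succ))).card : ℝ) / (2 * m * v) := by
  have hmpos : (0 : ℝ) < m := Nat.cast_pos.mpr (by omega)
  have hw0 : ∀ i : Fin (K + 1), 0 ≤ (if i = 0 then (1 : ℝ) else 0) := fun i => by positivity
  refine ⟨?_, ?_⟩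
  · have h := multiHub_spectralGap_ge (e := e) (w := fun i : Fin (K + 1) => if i = 0 then (1 : ℝ) else 0) hK hm he
      hc hc1 hμ hμ1 hM hMrev hw0 hotOnlyWeight_sum (by simp) ht0 ht1 hp hp1 hγ₀ hdom hgap0
    simpa using h
  · have hAk : 0 < (∑ u ∈ A, μ k.succ u) * ∑ u ∈ Aᶜ, μ k.succ u := lt_of_lt_of_le hvpos hv
    have h := leastConnected_spectralGap_le (t := t) (M := M) (e := e) (φ := fun _ : Fin m => Equiv.refl S)
      (w := fun i : Fin (K + 1) => if i = 0 then (1 : ℝ) else 0) hm he hμ hμ1 hM hMrev hw0 hotOnlyWeight_sum ht0.le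
      ht1.le (fun _ _ => Iff.rfl) k.succ hAk (by rw [if_neg (Fin.succ_ne_zero k), zero_mul])
    rw [multistar_deg_eq hstar k] at h
    refine h.trans ?_
    have hnum : 0 ≤ t * ((univ.filter (fun r : Fin m => e r = ((0 : Fin (K + 1)), k.succ))).card : ℝ) :=
      by positivity
    exact div_le_div_of_nonneg_left hnum (by positivity) (mul_le_mul_of_nonneg_left hv (by positivity))

/-- **The multiplicities of the hub edges sum to at most `m`, so one of them is at most `m/K`** (`K ≥ 1`). [ours] -/
theorem exists_hubMult_le (hK : 1 ≤ K) (e : Fin m → Fin (K + 1) × Fin (K + 1)) :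
    ∃ k : Fin K, (K : ℝ) * ((univ.filter (fun r : Fin m => e r = ((0 : Fin (K + 1)), k.succ))).card : ℝ) ≤ m := by
  -- the fibres of `r ↦ (e r).2` are disjoint
  have hsum : ∑ k : Fin K, (univ.filter (fun r : Fin m => e r = ((0 : Fin (K + 1)), k.succ))).card ≤ m := by
    have hfib := Finset.card_eq_sum_card_fiberwise (s := (univ : Finset (Fin m))) (t := (univ : Finset (Fin (K + 1))))
      (f := fun r => (e r).2) (fun r _ => mem_univ _)
    rw [Finset.card_univ, Fintype.card_fin, Fin.sum_univ_succ] at hfib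
    have hle : ∀ k : Fin K, (univ.filter (fun r : Fin m => e r = ((0 : Fin (K + 1)), k.succ))).card
        ≤ (univ.filter (fun r : Fin m => (e r).2 = k.succ)).card := fun k =>
      Finset.card_le_card (Finset.monotone_filter_right univ fun r _ hr => by rw [hr])
    calc ∑ k : Fin K, (univ.filter (fun r : Fin m => e r = ((0 : Fin (K + 1)), k.succ))).card
        ≤ ∑ k : Fin K, (univ.filter (fun r : Fin m => (e r).2 = k.succ)).card := sum_le_sum fun k _ => hle k
      _ ≤ m := by omega
  by_contra hne
  push Not at hne
  have hKne : (univ : Finset (Fin K)).Nonempty := ⟨⟨0, by omega⟩, mem_univ _⟩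
  have hlt : ∑ _k : Fin K, (m : ℝ) < ∑ k : Fin K,
      (K : ℝ) * ((univ.filter (fun r : Fin m => e r = ((0 : Fin (K + 1)), k.succ))).card : ℝ) :=
    Finset.sum_lt_sum_of_nonempty hKne fun k _ => hne k
  rw [Finset.sum_const, Finset.card_univ, Fintype.card_fin, nsmul_eq_mul, ← Finset.mul_sum] at hlt
  have hsum' : (∑ k : Fin K, ((univ.filter (fun r : Fin m => e r = ((0 : Fin (K + 1)), k.succ))).card : ℝ)) ≤ m := by
    exact_mod_cast hsum
  have hKpos : (0 : ℝ) < K := Nat.cast_pos.mpr (by omega)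
  nlinarith

/-- **NO PROPOSAL LAW ON THE STAR BEATS `t/(2Kv)`:** every entry a hub edge, ANY multiplicities (any rational proposal
law over the hub edges), ANY update allocation with idle cold replicas (`w_{k+1}·Q_{k+1}(A,Aᶜ) = 0`), and a sector with
`μ_k(A)μ_k(Aᶜ) ≥ v > 0` at the cold levels: **`Gap(P) ≤ t/(2K·v)`** (`K, m ≥ 1`, `|S| ≥ 2`, `0 ≤ t ≤ 1`). [ours] -/
theorem multistar_spectralGap_le_uniformLaw [Nontrivial S] (hK : 1 ≤ K) (hm : 1 ≤ m) (hstar : ∀ r, (e r).1 = 0)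
    (he : ∀ r, (e r).1 ≠ (e r).2) (hμ : ∀ k x, 0 < μ k x) (hμ1 : ∀ k, ∑ u, μ k u = 1)
    (hM : ∀ k, IsRowStochastic (M k)) (hMrev : ∀ k, DetailedBalance (μ k) (M k)) (hw0 : ∀ k, 0 ≤ w k)
    (hw1 : ∑ k, w k = 1) (ht0 : 0 ≤ t) (ht1 : t ≤ 1) {A : Finset S} (hφA : ∀ r u, φ r u ∈ A ↔ u ∈ A) {v : ℝ}
    (hvpos : 0 < v) (hv : ∀ k : Fin (K + 1), k ≠ 0 → v ≤ (∑ u ∈ A, μ k u) * ∑ u ∈ Aᶜ, μ k u)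
    (hidle : ∀ k : Fin (K + 1), k ≠ 0 → w k * edgeMeasure (μ k) (M k) A Aᶜ = 0) :
    spectralGap (tensorFun μ) (fun x y : Fin (K + 1) → S => t * ptGraphSwap μ e φ x y + (1 - t) * prodKernel w M x y)
      ≤ t / (2 * K * v) := by
  have hKpos : (0 : ℝ) < K := Nat.cast_pos.mpr (by omega)
  have hmpos : (0 : ℝ) < m := Nat.cast_pos.mpr (by omega)
  obtain ⟨k, hk⟩ := exists_hubMult_le hK e
  have hAk : 0 < (∑ u ∈ A, μ k.succ u) * ∑ u ∈ Aᶜ, μ k.succ u := lt_of_lt_of_le hvpos (hv k.succ (Fin.succ_ne_zero k))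
  have h := leastConnected_spectralGap_le (t := t) (M := M) (e := e) (φ := φ) (w := w) hm he hμ hμ1 hM hMrev hw0 hw1
    ht0 ht1 hφA k.succ hAk (hidle k.succ (Fin.succ_ne_zero k))
  rw [multistar_deg_eq hstar k] at h
  refine h.trans ?_
  rw [div_le_div_iff₀ (by positivity) (by positivity)]
  have hvk := hv k.succ (Fin.succ_ne_zero k)
  calc t * ((univ.filter (fun r : Fin m => e r = ((0 : Fin (K + 1)), k.succ))).card : ℝ) * (2 * K * v)
      = 2 * t * v * ((K : ℝ) * ((univ.filter (fun r : Fin m => e r = ((0 : Fin (K + 1)), k.succ))).card : ℝ)) := by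
        ring
    _ ≤ 2 * t * v * m := mul_le_mul_of_nonneg_left hk (by positivity)
    _ = t * (2 * m * v) := by ring
    _ ≤ t * (2 * m * ((∑ u ∈ A, μ k.succ u) * ∑ u ∈ Aᶜ, μ k.succ u)) :=
        mul_le_mul_of_nonneg_left (mul_le_mul_of_nonneg_left hvk (by positivity)) ht0

end Summit.Ventures.LatticeQCDFlow.Scaling

end
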